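import Literature.AlgebraicGeometry.Resolution.NormalDegreePDefectlessVT
import Literature.AlgebraicGeometry.Resolution.NormalDegreePDefectlessInseparable
import Literature.AlgebraicGeometry.Resolution.GeneralizedStabilityLemma55VT
import HarnessLib

/-!
# Purely inseparable extensions of degree `p` of `K(y)^h` with `y` value-transcendental are defectless (Kuhlmann 2010, §5 pp. 19–20 with Prop. 3.1) — proof

Topic: `Literature/AlgebraicGeometry/Resolution` (valued function fields). DISCHARGE of the named
fact `Kuhlmann2010PurelyInseparableDegreePDefectlessVT` (`NormalDegreePDefectlessVT.lean`), the
purely inseparable half of "the first extension in the tower is defectless by Corollary 4.2 or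
Proposition 3.1" (F.-V. Kuhlmann, *Elimination of ramification I: The generalized stability
theorem*, Trans. AMS 362 (2010) 5697–5727 = arXiv:1003.5678, §5, proof of (R4), pp. 19–20) in
the value-transcendental case (4.2): for `N = K(y)^h = henselizedAdjoin V K y` with `y`
value-transcendental over the algebraically closed `K` inside the algebraically closed `(Ω, V)`,
and `N ≤ N'` purely inseparable of degree `p`, `[N' : N] = (vN' : vN)·[N'v : Nv]`.
Value-transcendental twin of `NormalDegreePDefectlessInseparable.lean`.

The source obtains this from Prop. 3.1 (the "inseparably defectless" Generalized Stability
Theorem) transported to the henselization by Thm. 2.14. The printed proof of Prop. 3.1 (p. 10)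
is a degree count for `E = K'(𝒯^{1/p^m})` over `K(𝒯)` resting on Lemma 2.1: "the values
`vxᵢ^{1/p^m} = vxᵢ/p^m` … are still rationally independent over `vK'` …
`vE = vK' ⊕ ℤ vx₁/p^m ⊕ … ⊕ ℤ vx_r/p^m` … `[E:K(𝒯)] = … = (vE:vK(𝒯))·[Ē:K(𝒯)‾]`". The proof
given here is that computation for the one purely inseparable extension of degree `p` of
`N = K(y)^h`, which is `N(y^{1/p})` (`r = 1`, `s = 0`, `K' = K` perfect, `m = 1`), carried to
the henselization by Lemma 2.2 (`K(y)^h|K(y)` is immediate) instead of Thm. 2.14: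

* `char Ω = p` (a purely inseparable extension of prime degree `p` exists), and every `w ∈ N'`
  has `w^p ∈ N` (`pow_mem_of_purelyInseparable_of_finrank_eq`);
* `N|K(y)` is separable (the henselization lies in the separable closure,
  `isSeparable_of_mem_henselization`); hence, with `t^p = y`, `N' ⊆ N(t)`
  (`le_adjoin_of_pow_mem_of_isSeparable`, `adjoin_le_map_frobenius`: `K = K^p`, `y = t^p`), and
  as `[N(t) : N] ≤ p = [N' : N]`, `t ∈ N'` (`mem_of_le_adjoin_of_finrank_eq`);
* `v(t) = v(y)/p ∉ vN`: `vN = vK(y)` (Lemma 2.2, `Kuhlmann2010HenselizationImmediate_holds`) and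
  `vK(y) = vK ⊕ ℤ·vy` (Lemma 2.1 / Lemma 2.5, `exists_valuation_eq_of_mem_adjoin`), so
  `v(t) = v(c) + m·vy` would give `(1 − mp)·vy = v(c^p) ∈ vK` with `1 − mp ≠ 0`, contradicting
  the rational independence of `vy` over `vK`;
* hence the class of `v(t)` in `vN'/vN` has order exactly `p`, so `p ∣ (vN' : vN)`
  (`dvd_relIndex_of_pow_mem`), and the fundamental inequality `(vN' : vN)·[N'v : Nv] ≤ p`
  forces `(vN' : vN) = p`, `[N'v : Nv] = 1`: the extension is defectless.

## Content (everything PROVED)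

* `dvd_relIndex_of_pow_mem` — in a commutative group, `g ∈ K ∖ H` with `g^p ∈ H`, `p` prime,
  gives `p ∣ (K : H ∩ K)`.
* `valuation_ne_of_pow_eq_of_mem_henselizedAdjoin` — `v(t) ∉ v(K(y)^h)` for `t^p = y`, `y`
  value-transcendental over `K`, `p` prime.
* `isDefectlessExtension_henselizedAdjoin_of_purelyInseparable` and
  `Kuhlmann2010PurelyInseparableDegreePDefectlessVT_holds`.
* `isDefectlessExtension_of_isNormalStep_henselizedAdjoin_of_galois` — the normal steps of
  degree `p` over `K(y)^h` now rest on Cor. 4.2 (`Kuhlmann2010GaloisDegreePDefectlessVT`) alone.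

## Sources

* F.-V. Kuhlmann, *Elimination of ramification I: The generalized stability theorem*, Trans.
  Amer. Math. Soc. 362 (2010) 5697–5727 = arXiv:1003.5678: §1 (1) (fundamental inequality),
  Lemma 2.1, Lemma 2.2, Lemma 2.5, Thm. 2.14, §3 Prop. 3.1 (and its proof, p. 10), §5 proof of
  (R4), pp. 19–20 ("Then the first extension in the tower is defectless by Corollary 4.2 or
  Proposition 3.1"; "By Corollary 4.2 or Proposition 3.1, this extension is defectless").

## Rendering notes

* The hypotheses "`N` of rank one" and "`char Ωv = p`" of the named fact are not needed for the
  purely inseparable case and are not assumed in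
  `isDefectlessExtension_henselizedAdjoin_of_purelyInseparable`.
-/

noncomputable section

open IsLocalRing

namespace Literature.AlgebraicGeometry.Resolution

universe u

/-! ### A group-theoretic lemma: elements of order `p` modulo a subgroup -/

section Group

/-- **If `g ∈ K`, `g ∉ H` and `g^p ∈ H` for a prime `p` (in a commutative group), then `p`
divides the relative index `(K : H ∩ K)`**: the class of `g` in `K/(H ∩ K)` has order `p`, and
the order of an element divides the cardinality (`0` if infinite). [folklore] -/
theorem dvd_relIndex_of_pow_mem {G : Type*} [CommGroup G] {H K : Subgroup G} {p : ℕ}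
    (hp : p.Prime) {g : G} (hgK : g ∈ K) (hgH : g ∉ H) (hgp : g ^ p ∈ H) :
    p ∣ H.relIndex K := by
  haveI : Fact p.Prime := ⟨hp⟩
  have h1 : (QuotientGroup.mk (⟨g, hgK⟩ : K) : K ⧸ H.subgroupOf K) ≠ 1 := by
    rw [Ne, QuotientGroup.eq_one_iff, Subgroup.mem_subgroupOf]
    exact hgH
  have h2 : (QuotientGroup.mk (⟨g, hgK⟩ : K) : K ⧸ H.subgroupOf K) ^ p = 1 := by
    rw [← QuotientGroup.mk_pow, QuotientGroup.eq_one_iff, Subgroup.mem_subgroupOf]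
    exact hgp
  rw [Subgroup.relIndex, Subgroup.index, ← orderOf_eq_prime h2 h1]
  exact orderOf_dvd_natCard _

end Group

variable {Ω : Type u} [Field Ω] (V : ValuationSubring Ω)

/-! ### `v(y^{1/p}) ∉ v(K(y)^h)` -/

section Values

/-- **`v(t) ∉ v(K(y)^h)` for `t^p = y`, `p` prime, `y` value-transcendental over `K`**
(Kuhlmann 2010, Lemma 2.2: `K(y)^h|K(y)` is immediate, so `vK(y)^h = vK(y)`; Lemma 2.1 /
Lemma 2.5: `vK(y) = vK ⊕ ℤvy`): `v(t) = v(c)·v(y)^m` with `c ∈ K` would give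
`v(y)^{1 − mp} = v(c^p)` with `1 − mp ≠ 0`. PROVED. [cite: Kuhlmann2010, Lemma 2.2 and Lemma 2.5] -/
theorem valuation_ne_of_pow_eq_of_mem_henselizedAdjoin [IsAlgClosed Ω] {K : Subfield Ω} {y : Ω}
    (hy : IsValueTranscendentalOver V K y) {p : ℕ} (hp : p.Prime) {t : Ω} (hty : t ^ p = y)
    {z : Ω} (hz : z ∈ henselizedAdjoin V K y) : V.valuation t ≠ V.valuation z := by
  intro h
  have hvy0 : V.valuation y ≠ 0 := (map_ne_zero _).mpr hy.ne_zero
  have hvt0 : V.valuation t ≠ 0 := by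
    intro h0
    apply hvy0
    rw [← hty, map_pow, h0, zero_pow hp.ne_zero]
  have hz0 : z ≠ 0 := by
    rintro rfl
    rw [map_zero] at h
    exact hvt0 h
  -- `v(z) = v(a)` for some `a ∈ K(y)` (the henselization is immediate, Lemma 2.2)
  obtain ⟨a, haKy, hza⟩ := (Kuhlmann2010HenselizationImmediate_holds Ω V
    (IntermediateField.adjoin K ({y} : Set Ω)).toSubfield).1 z hz hz0
  have ha0 : a ≠ 0 := by
    rintro rfl
    rw [map_zero] at hza
    exact hvt0 (h.trans hza)
  -- `v(a) = v(c)·v(y)^m` (Lemma 2.5)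
  obtain ⟨c, hcK, m, hac⟩ := exists_valuation_eq_of_mem_adjoin hy haKy ha0
  -- `v(c)^p · (v(y)^m)^p = v(t)^p = v(y)`
  have h1 : V.valuation c ^ p * (V.valuation y ^ m) ^ p = V.valuation y := by
    rw [← mul_pow, ← hac, ← hza, ← h, ← map_pow, hty]
  have hne : (1 : ℤ) - m * p ≠ 0 := by
    intro h0
    have hmp : m * (p : ℤ) = 1 := (sub_eq_zero.mp h0).symm
    have hp1 : (p : ℤ) = 1 := Int.eq_one_of_mul_eq_one_left (by positivity) hmp
    exact hp.ne_one (by exact_mod_cast hp1)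
  have key : V.valuation y ^ ((1 : ℤ) - m * p) = V.valuation (c ^ p) := by
    rw [zpow_sub₀ hvy0, zpow_one, zpow_mul, zpow_natCast, map_pow,
      div_eq_iff (pow_ne_zero _ (zpow_ne_zero _ hvy0))]
    exact h1.symm
  exact hy.zpow_ne hne (K.pow_mem hcK p) key

end Values

/-! ### The purely inseparable case over `K(y)^h` -/

section Main

/-- **Kuhlmann 2010, pp. 19–20 ("… or Proposition 3.1, this extension is defectless"), the
purely inseparable steps over `K(y)^h` with `y` value-transcendental, PROVED directly**: for
`K ≤ Ω` algebraically closed, `y` value-transcendental over `K`, `N = K(y)^h` and `N ≤ N'`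
purely inseparable of prime degree `p`, `[N' : N] = (vN' : vN)·[N'v : Nv]`. Proof: `char Ω = p`;
`N|K(y)` is separable, so with `t = y^{1/p}`: `N' ⊆ N(t)`, hence `t ∈ N'` by degrees;
`v(t) ∉ vN = vK ⊕ ℤvy` while `v(t)^p = vy ∈ vN`, so `p ∣ (vN' : vN)`; with
`(vN' : vN)·[N'v : Nv] ≤ p`: `(vN' : vN) = p`, `[N'v : Nv] = 1` (the degree count of the proof
of Prop. 3.1 with `r = 1`, `s = 0`, `m = 1`).
[cite: Kuhlmann2010, Section 5, proof of (R4) (pp. 19–20), with Prop. 3.1] -/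
theorem isDefectlessExtension_henselizedAdjoin_of_purelyInseparable [IsAlgClosed Ω] {p : ℕ}
    (hp : p.Prime) {K : Subfield Ω} (hK : IsAlgClosed K) {y : Ω}
    (hy : IsValueTranscendentalOver V K y) {N' : Subfield Ω} (hNN' : henselizedAdjoin V K y ≤ N')
    (hdeg : Module.finrank (henselizedAdjoin V K y) (Subfield.extendScalars hNN') = p)
    (hpi : IsPurelyInseparable (henselizedAdjoin V K y) (Subfield.extendScalars hNN')) :
    IsDefectlessExtension V (henselizedAdjoin V K y) N' := by
  haveI : Fact p.Prime := ⟨hp⟩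
  haveI := hpi
  set Ky : Subfield Ω := (IntermediateField.adjoin K ({y} : Set Ω)).toSubfield with hKydef
  set N : Subfield Ω := henselizedAdjoin V K y with hNdef
  -- characteristic `p`
  haveI : CharP Ω p := charP_of_purelyInseparable_of_finrank_eq hp _ hdeg
  haveI : ExpChar Ω p := ExpChar.prime hp
  -- inclusions
  have hKKy : K ≤ Ky := subfield_le_toSubfield _
  have hKyN : Ky ≤ N := le_henselization V Ky
  have hKN : K ≤ N := hKKy.trans hKyN
  have hyKy : y ∈ Ky := IntermediateField.subset_adjoin K ({y} : Set Ω) rfl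
  have hyN : y ∈ N := hKyN hyKy
  -- degrees
  have hrel : Subfield.relfinrank N N' = p := by
    rw [Subfield.relfinrank_eq_finrank_of_le hNN', hdeg]
  have hpos : 0 < Subfield.relfinrank N N' := by
    rw [hrel]
    exact hp.pos
  -- `w^p ∈ N` for `w ∈ N'`
  have hpow : ∀ w ∈ N', w ^ p ∈ N := fun w hw =>
    pow_mem_of_purelyInseparable_of_finrank_eq p hNN' hdeg hw
  -- `N|K(y)` is separable: the henselization lies in the separable closure
  have hsep : ∀ z ∈ N, IsSeparable Ky z := fun z hz => isSeparable_of_mem_henselization V Ky hz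
  -- `t = y^{1/p}` lies in `N'`
  obtain ⟨t, hty⟩ := IsAlgClosed.exists_pow_nat_eq y hp.pos
  have htp : t ^ p ∈ N := by
    rw [hty]
    exact hyN
  have hle : N' ≤ (IntermediateField.adjoin N ({t} : Set Ω)).toSubfield :=
    le_adjoin_of_pow_mem_of_isSeparable p hpow hsep (adjoin_le_map_frobenius p hp.pos hK hKN hty)
  have htN' : t ∈ N' := mem_of_le_adjoin_of_finrank_eq p hNN' hdeg htp hle
  have ht0 : t ≠ 0 := by
    intro h0
    apply hy.ne_zero
    rw [← hty, h0, zero_pow hp.ne_zero]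
  -- the value `γ = v(t) ∈ vN'` has `γ ∉ vN`, `γ^p ∈ vN`
  have hvt0 : V.valuation t ≠ 0 := (map_ne_zero _).mpr ht0
  set γ : (ValuationSubring.ValueGroup V)ˣ := Units.mk0 (V.valuation t) hvt0 with hγdef
  have hγN' : γ ∈ valueSubgroup N' V :=
    (mem_valueSubgroup_iff N' V γ).mpr ⟨⟨t, htN'⟩, fun h0 => ht0 (congrArg Subtype.val h0), rfl⟩
  have hγN : γ ∉ valueSubgroup N V := by
    intro hmem
    obtain ⟨c, -, hγc⟩ := (mem_valueSubgroup_iff N V γ).mp hmem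
    exact valuation_ne_of_pow_eq_of_mem_henselizedAdjoin V hy hp hty c.2 hγc
  have hγpN : γ ^ p ∈ valueSubgroup N V := by
    refine (mem_valueSubgroup_iff N V _).mpr
      ⟨⟨t ^ p, htp⟩, fun h0 => pow_ne_zero p ht0 (congrArg Subtype.val h0), ?_⟩
    rw [Units.val_pow_eq_pow_val, hγdef, Units.val_mk0, ← map_pow]
    rfl
  have hdvd : p ∣ (valueSubgroup N V).relIndex (valueSubgroup N' V) :=
    dvd_relIndex_of_pow_mem hp hγN' hγN hγpN
  -- the fundamental inequality `e·f ≤ p` with `p ∣ e`: `e = p`, `f = 1`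
  obtain ⟨he, hf, hef⟩ := relIndex_mul_relfinrank_le_relfinrank V hNN' hpos
  rw [hrel] at hef
  have he_eq : (valueSubgroup N V).relIndex (valueSubgroup N' V) = p :=
    le_antisymm (le_trans (Nat.le_mul_of_pos_right _ hf) hef) (Nat.le_of_dvd he hdvd)
  have hf_eq : (residueSubfield N V).relfinrank (residueSubfield N' V) = 1 := by
    rw [he_eq] at hef
    have h1 : (residueSubfield N V).relfinrank (residueSubfield N' V) ≤ 1 :=
      Nat.le_of_mul_le_mul_left (by rw [mul_one]; exact hef) hp.pos
    exact le_antisymm h1 hf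
  -- conclusion
  refine ⟨hNN', hpos, ?_⟩
  rw [hrel, he_eq, hf_eq, mul_one]

end Main

/-! ### Discharge of the named fact -/

/-- **DISCHARGE of `Kuhlmann2010PurelyInseparableDegreePDefectlessVT`** (Kuhlmann 2010, pp. 19–20
with Prop. 3.1 and Thm. 2.14: purely inseparable extensions of degree `p` of the henselized
rational function field `K(y)^h` of rank one with `y` value-transcendental over an algebraically
closed field are defectless). PROVED (`isDefectlessExtension_henselizedAdjoin_of_purelyInseparable`;
the rank-one hypothesis is not used).
[cite: Kuhlmann2010, Prop. 3.1 and Thm. 2.14 (with Section 5 pp. 19–20)] -/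
theorem Kuhlmann2010PurelyInseparableDegreePDefectlessVT_holds :
    Kuhlmann2010PurelyInseparableDegreePDefectlessVT.{u} := by
  intro Ω _ _ V p _ hp K hK y hy _ N' hstep
  obtain ⟨hle, hdeg, hpi⟩ := hstep
  exact isDefectlessExtension_henselizedAdjoin_of_purelyInseparable V hp hK hy hle hdeg hpi

/-- **The normal steps of degree `p` over `K(y)^h` now rest on Cor. 4.2 alone**: a normal
extension of degree `p` of `N = K(y)^h` of rank one, `y` value-transcendental over the
algebraically closed `K`, is defectless, from `Kuhlmann2010GaloisDegreePDefectlessVT` (the Galois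
steps) and the discharged purely inseparable case. PROVED.
[cite: Kuhlmann2010, Section 5, proof of (R4) (pp. 19–20), with Cor. 4.2] -/
theorem isDefectlessExtension_of_isNormalStep_henselizedAdjoin_of_galois
    (hG : Kuhlmann2010GaloisDegreePDefectlessVT.{u})
    {Ω : Type u} [Field Ω] [IsAlgClosed Ω] (V : ValuationSubring Ω) {p : ℕ} [CharP (ResidueField V) p]
    (hp : p.Prime) {K : Subfield Ω} (hK : IsAlgClosed K) {y : Ω} (hy : IsValueTranscendentalOver V K y)
    (hr : IsRankOneValued V (henselizedAdjoin V K y)) {N' : Subfield Ω}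
    (hstep : IsNormalStep p (henselizedAdjoin V K y) N') :
    IsDefectlessExtension V (henselizedAdjoin V K y) N' :=
  isDefectlessExtension_of_isNormalStep_henselizedAdjoin hG
    Kuhlmann2010PurelyInseparableDegreePDefectlessVT_holds V hp hK hy hr hstep

end Literature.AlgebraicGeometry.Resolution
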